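import Summits.QuantumFields.YangMills.Theorems.BalabanLadderIRcofEquipartitionSeamSliceRealisation
import Summits.QuantumFields.YangMills.Theorems.BalabanLadderIRcofEquipartitionSeamSpectralDict
import HarnessLib

/-!
# Row 47 `equipartition_seam` — stub T (`VacuumSlackV`) is MONOTONE IN THE EXTENT DEFICIT `ϱ`:
# it reduces, via the LANDED spectral dictionary D, to its single extreme member `ϱ = ⌊(2S+1)/4⌋`

Crux `IRcof` (stmt-QuantumFields-26930), line `Cruxes/IRcof/Lines/equipartition_seam.lean` (skeleton rev 10), stub
T `stub_vacuumSlackV : KernelCurrency.VacuumSlackV`.  HONEST: nothing here is a constructive-QFT estimate; the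
Yang–Mills mass gap (Clay) is NOT proved; `IRcof` ∕ `IR` 0 ∕ 1.  This file is sorry-free bookkeeping that SHRINKS the
located stub T to one inequality per box.

T says: for `S ≥ S_T`, every sector `z` and every `ϱ` with `4ϱ ≤ 2S+1`,
`λ₊(z;S)^ϱ · Z_w(elOff z; 2S+1−ϱ) ≤ C_T · Z_w(elOff z; 2S+1)`.
By D (`KernelCurrency.SpectralDictV`, a THEOREM since p696729 + p703079: `Z_w(z₀|e; m) = Σᵢ χᵢ(e) λᵢ^m` for `m ≥ 2`
with `0 ≤ λᵢ ≤ λ₊`), at `e = 1` every term `λ₊^ϱ λᵢ^{n−ϱ} = λᵢ^n (λ₊/λᵢ)^ϱ` is NON-DECREASING in `ϱ`; hence the member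
`ϱ_S := (2S+1)/4` (natural division) implies all the others with the SAME constant.  So T is equivalent (given D) to

  T_ext `VacuumSlackExtV`: `∃ C_T β_T S_T, 0 < C_T ∧ ∀ β ≥ β_T, ∀ w admissible, ∀ S ≥ S_T β, ∀ z,`
         `λ₊(z;S)^{ϱ_S} · Z_w(elOff z; 2S+1−ϱ_S) ≤ C_T · Z_w(elOff z; 2S+1)`,

ONE inequality per `(S, z)`, comparing the two ENDS `s = 2S+1−ϱ_S ≈ ¾(2S+1)` and `s = 2S+1` of the near-cubic window on
which S3ʷ (`EquiWindowV`) is stated — after this reduction the two located thermal inputs of S4ᵛ (S3ʷ and T) speak about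
the same pair of boxes `¾t × t³` and `t⁴`.

Main results (namespace `Summit.QuantumFields.YangMills.Cruxes.IRcof.EquipartitionSeam.VacuumSlack`):
* `vacuumSlackOn_of_spectralDictOn_of_ext` — per `(π, w)`: `SpectralDictOn … S_D` and the extreme inequality beyond `S_T`
  give `VacuumSlackOn π w C_T (max S_D S_T)`;
* `vacuumSlackV_of_ext : VacuumSlackExtV → KernelCurrency.VacuumSlackV` — unconditional (D is landed:
  `SpectralDict.spectralDictV_of_sliceRealisationV SliceKernel.sliceRealisationV_holds`);
* `ext_of_vacuumSlackV : KernelCurrency.VacuumSlackV → VacuumSlackExtV` — the converse (instance `ϱ = ϱ_S`), so the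
  reduction loses nothing.
-/

open MeasureTheory Filter Topology
open scoped BigOperators ComplexConjugate

namespace Summit.QuantumFields.YangMills.Cruxes.IRcof.EquipartitionSeam.VacuumSlack

open Literature.MathematicalPhysics.QuantumFieldTheory Literature.MathematicalPhysics.QuantumLattice
open Summit.QuantumFields.YangMills.Theorems.NonSimplyConnectedLatticeGap
open Summit.QuantumFields.YangMills.Cruxes.IRcof.EquipartitionSeam.KernelCurrency

/-! ## §1 Termwise monotonicity in `ϱ` -/

/-- `Λ^ϱ · λ^(n−ϱ)` is non-decreasing in `ϱ ≤ n` when `0 ≤ λ ≤ Λ`. -/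
theorem pow_mul_pow_sub_mono {Λ lam : ℝ} (h0 : 0 ≤ lam) (hle : lam ≤ Λ) {ϱ ϱ' n : ℕ} (hϱ : ϱ ≤ ϱ')
    (hϱ' : ϱ' ≤ n) : Λ ^ ϱ * lam ^ (n - ϱ) ≤ Λ ^ ϱ' * lam ^ (n - ϱ') := by
  have hΛ : 0 ≤ Λ := h0.trans hle
  obtain ⟨d, rfl⟩ := Nat.exists_eq_add_of_le hϱ
  have h1 : n - ϱ = d + (n - (ϱ + d)) := by omega
  rw [h1, pow_add, pow_add, ← mul_assoc]
  refine mul_le_mul_of_nonneg_right ?_ (pow_nonneg h0 _)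
  exact mul_le_mul_of_nonneg_left (pow_le_pow_left₀ h0 hle d) (pow_nonneg hΛ _)

/-! ## §2 The per-`(π, w)` reduction -/

section PerWeight

variable {G H : Type} [Group G] [TopologicalSpace G] [MeasurableSpace G] [Group H] [TopologicalSpace H]
  [IsTopologicalGroup H] [CompactSpace H] [MeasurableSpace H] [BorelSpace H]

/-- **T at one `w`, EXTREME member only**: for `S ≥ S_T` and every sector `z`, with `ϱ_S := (2S+1)/4`,
`λ₊(z;S)^{ϱ_S} · Z_w(elOff z; 2S+1−ϱ_S) ≤ C_T · Z_w(elOff z; 2S+1)`. -/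
def VacuumSlackExtOn (π : H →* G) (w : H → ℝ) (C_T : ℝ) (S_T : ℕ) : Prop :=
  ∀ S : ℕ, S_T ≤ S → ∀ z : Sector π,
    growthRate π w z S ^ ((2 * S + 1) / 4) * secZ π w (elOff π z) S (2 * S + 1 - (2 * S + 1) / 4) ≤
      C_T * secZ π w (elOff π z) S (2 * S + 1)

omit [TopologicalSpace G] in
/-- From D at `(S, z)`: the untwisted traces are real power sums `Z_w(elOff z; m) = Σᵢ λᵢ^m` (`m ≥ 2`) with
`0 ≤ λᵢ ≤ λ₊(z; S)`. -/
theorem exists_hasSum_pow_of_spectralDictOn {π : H →* G} {w : H → ℝ} {thick : YMSpecies G → ℕ}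
    {nrm : YMSpecies G → ℝ} {S_D : ℕ} (hD : SpectralDictOn π w thick nrm S_D) {S : ℕ} (hS : S_D ≤ S)
    (z : Sector π) :
    ∃ (ι : Type) (lam : ι → ℝ), (∀ i, 0 ≤ lam i ∧ lam i ≤ growthRate π w z S) ∧
      ∀ m : ℕ, 2 ≤ m → HasSum (fun i => lam i ^ m) (secZ π w (elOff π z) S m) := by
  obtain ⟨ι, lam, χ, hlam, hχmul, hχnorm, hZ, -⟩ := hD S hS z
  have hχ1 : ∀ i, χ i 1 = 1 := fun i => by
    have hne : χ i 1 ≠ 0 := fun h0 => by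
      have h := hχnorm i 1; rw [h0, norm_zero] at h; exact zero_ne_one h
    have h1 : χ i 1 * χ i 1 = χ i 1 * 1 := by rw [mul_one, ← hχmul, mul_one]
    exact mul_left_cancel₀ hne h1
  refine ⟨ι, lam, hlam, fun m hm => ?_⟩
  have h := hZ m hm 1
  simp_rw [hχ1, one_mul] at h
  have h' : HasSum (fun i => ((lam i ^ m : ℝ) : ℂ)) ((secZ π w (withEl π z 1) S m : ℝ) : ℂ) := h
  exact Complex.hasSum_ofReal.mp h'

omit [TopologicalSpace G] [MeasurableSpace G] in
/-- **Monotonicity in `ϱ`.**  Given D's power sums at `(S, z)`, the slack ratio `λ₊^ϱ Z(n−ϱ)` is non-decreasing in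
`ϱ` as long as `n − ϱ ≥ 2`. -/
theorem growthRate_pow_mul_secZ_mono {π : H →* G} {w : H → ℝ} {S : ℕ} {z : Sector π} {ι : Type} {lam : ι → ℝ}
    (hlam : ∀ i, 0 ≤ lam i ∧ lam i ≤ growthRate π w z S)
    (hZ : ∀ m : ℕ, 2 ≤ m → HasSum (fun i => lam i ^ m) (secZ π w (elOff π z) S m)) {ϱ ϱ' n : ℕ}
    (hϱ : ϱ ≤ ϱ') (hn : ϱ' + 2 ≤ n) :
    growthRate π w z S ^ ϱ * secZ π w (elOff π z) S (n - ϱ) ≤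
      growthRate π w z S ^ ϱ' * secZ π w (elOff π z) S (n - ϱ') := by
  have h1 : HasSum (fun i => growthRate π w z S ^ ϱ * lam i ^ (n - ϱ))
      (growthRate π w z S ^ ϱ * secZ π w (elOff π z) S (n - ϱ)) := (hZ (n - ϱ) (by omega)).mul_left _
  have h2 : HasSum (fun i => growthRate π w z S ^ ϱ' * lam i ^ (n - ϱ'))
      (growthRate π w z S ^ ϱ' * secZ π w (elOff π z) S (n - ϱ')) := (hZ (n - ϱ') (by omega)).mul_left _
  exact hasSum_le (fun i => pow_mul_pow_sub_mono (hlam i).1 (hlam i).2 hϱ (by omega)) h1 h2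

omit [TopologicalSpace G] in
/-- **The per-weight reduction.**  D beyond `S_D` and the EXTREME slack beyond `S_T` give the full vacuum slack T
beyond `max S_D S_T`, with the same constant. -/
theorem vacuumSlackOn_of_spectralDictOn_of_ext {π : H →* G} {w : H → ℝ} {thick : YMSpecies G → ℕ}
    {nrm : YMSpecies G → ℝ} {S_D : ℕ} (hD : SpectralDictOn π w thick nrm S_D) {C_T : ℝ} {S_T : ℕ}
    (hT : VacuumSlackExtOn π w C_T S_T) : VacuumSlackOn π w C_T (max S_D S_T) := by
  intro S hS z ϱ hϱ
  have hSD : S_D ≤ S := (le_max_left _ _).trans hS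
  have hST : S_T ≤ S := (le_max_right _ _).trans hS
  have hext := hT S hST z
  -- `ϱ ≤ ϱ_S := (2S+1)/4`
  have hle : ϱ ≤ (2 * S + 1) / 4 := by omega
  rcases Nat.eq_or_lt_of_le hle with h | h
  · rw [h]; exact hext
  · -- here `S ≥ 1` automatically (`ϱ < (2S+1)/4` forces `(2S+1)/4 ≥ 1`), so all extents involved are `≥ 2`
    obtain ⟨ι, lam, hlam, hZ⟩ := exists_hasSum_pow_of_spectralDictOn hD hSD z
    have hmono := growthRate_pow_mul_secZ_mono hlam hZ (le_of_lt h) (n := 2 * S + 1) (by omega)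
    exact hmono.trans hext

omit [TopologicalSpace G] [MeasurableSpace G] in
/-- Conversely the extreme member is an instance of T. -/
theorem ext_of_vacuumSlackOn {π : H →* G} {w : H → ℝ} {C_T : ℝ} {S_T : ℕ} (hT : VacuumSlackOn π w C_T S_T) :
    VacuumSlackExtOn π w C_T S_T := fun S hS z => hT S hS z _ (Nat.mul_div_le (2 * S + 1) 4 |>.trans_eq' (by ring))

end PerWeight

/-! ## §3 The `V`-level statement and the unconditional reduction (D is landed) -/

/-- **T_ext `VacuumSlackExtV`** — the vacuum thermal slack for every admissible split weight, EXTREME MEMBER ONLY: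
beyond thresholds `β_T`, `S_T β`, one constant `C_T > 0` with
`λ₊(z;S)^{ϱ_S} · Z_w(elOff z; 2S+1−ϱ_S) ≤ C_T · Z_w(elOff z; 2S+1)`, `ϱ_S = (2S+1)/4`, for every `S ≥ S_T β` and every
sector `z`.  Same outer binders as `KernelCurrency.VacuumSlackV`.  LOCATED (finite-size thermal bound at aspect ratio
`3 : 4`, uniform in the volume and in `β`); why it might fail: an unbounded vacuum-normalised thermal multiplicity
`Σᵢ (λᵢ/λ₊)^{¾(2S+1)}` along `β → ∞`, `S = S_T(β)` (femto-universe ∕ toron regime) — the weak-coupling prediction is the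
bounded `(4/3)^{3·rank/2} · |ker π|³ · (1 + o(1))`. -/
def VacuumSlackExtV : Prop :=
  ∀ (G : Type) [Group G] [TopologicalSpace G] [IsTopologicalGroup G] [CompactSpace G] [MeasurableSpace G]
    [BorelSpace G], IsCompactSimpleLieGroup G → ∀ (H : Type) [Group H] [TopologicalSpace H] [IsTopologicalGroup H]
    [CompactSpace H] [MeasurableSpace H] [BorelSpace H], IsCompactSimpleLieGroup H → SimplyConnectedSpace H →
    ∀ (π : H →* G), Continuous π → Function.Surjective π → π.ker ≤ Subgroup.center H → (π.ker : Set H).Finite →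
    π.ker ≠ ⊥ → ∀ (ρH : LatticeRep H) (r : LatticeRep G) (c : ℝ → ℝ), Tendsto (fun β => c β * β) atTop atTop →
      ∃ (C_T β_T : ℝ) (S_T : ℝ → ℕ), 0 < C_T ∧ ∀ β : ℝ, β_T ≤ β → ∀ w : H → ℝ, TwistSplitWeight π ρH r (c β) β w →
        VacuumSlackExtOn π w C_T (S_T β)

/-- **T ⟸ T_ext, unconditionally** (the spectral dictionary D is the landed theorem
`SpectralDict.spectralDictV_of_sliceRealisationV SliceKernel.sliceRealisationV_holds`, p696729 + p703079). -/
theorem vacuumSlackV_of_ext (hT : VacuumSlackExtV) : KernelCurrency.VacuumSlackV := by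
  intro G _ _ _ _ _ _ hG H _ _ _ _ _ _ hH hsc π hπc hπs hker hfin hne ρH r c hc
  have hD : KernelCurrency.SpectralDictV :=
    SpectralDict.spectralDictV_of_sliceRealisationV SliceKernel.sliceRealisationV_holds
  obtain ⟨thick, nrm, β_D, S_D, hDmain⟩ := hD G hG H hH hsc π hπc hπs hker hfin hne ρH r c hc
  obtain ⟨C_T, β_T, S_T, hC, hTmain⟩ := hT G hG H hH hsc π hπc hπs hker hfin hne ρH r c hc
  refine ⟨C_T, max β_D β_T, fun β => max (S_D β) (S_T β), hC, fun β hβ w hw => ?_⟩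
  exact vacuumSlackOn_of_spectralDictOn_of_ext (hDmain β ((le_max_left _ _).trans hβ) w hw)
    (hTmain β ((le_max_right _ _).trans hβ) w hw)

/-- **T ⟹ T_ext** (instance `ϱ = ϱ_S`): the reduction is an equivalence. -/
theorem ext_of_vacuumSlackV (hT : KernelCurrency.VacuumSlackV) : VacuumSlackExtV := by
  intro G _ _ _ _ _ _ hG H _ _ _ _ _ _ hH hsc π hπc hπs hker hfin hne ρH r c hc
  obtain ⟨C_T, β_T, S_T, hC, hTmain⟩ := hT G hG H hH hsc π hπc hπs hker hfin hne ρH r c hc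
  exact ⟨C_T, β_T, S_T, hC, fun β hβ w hw => ext_of_vacuumSlackOn (hTmain β hβ w hw)⟩

/-- The two forms of stub T are equivalent. -/
theorem vacuumSlackV_iff_ext : KernelCurrency.VacuumSlackV ↔ VacuumSlackExtV :=
  ⟨ext_of_vacuumSlackV, vacuumSlackV_of_ext⟩

end Summit.QuantumFields.YangMills.Cruxes.IRcof.EquipartitionSeam.VacuumSlack
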